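import Literature.MeasureTheory.Group.CoveringWeightsPushforward
import Mathlib.Topology.Algebra.Group.OpenMapping
import Mathlib.Topology.Baire.LocallyCompactRegular
import HarnessLib

/-!
# Unfolding along a homomorphism with co-discrete image:
# `∫_{Γ∖G} g ∘ α = K · ∫_{𝓕 ∩ (P·α(G))} g` for a discrete `P ≥ α(Γ)`
(Rogawski, *Automorphic Representations of Unitary Groups in Three Variables* (1990), §7.2 p. 94: «`α₃` defines an
isomorphism of `MS∖M` with `NE^*∖NI_E`» — the torus integral becomes an integral over the NORM CLASSES, a subgroup of
index two of the idele classes of `F`; Folland (1995), §2.6 Thm. 2.49 for Weil's formula)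

Topic `MeasureTheory/Group`; namespace `Literature.MeasureTheory.Group`. THEOREMS ONLY over accepted tree modules: no
definition, no named fact, no instance, no notation, no `sorry`. Row (C-torus) FILE 3a of the T1-qs LAW 5 road of
`Cruxes/H413/Lines/F0_T1InnerFormTraceIdentity.lean` (cell `pub/hodgecm-mathlib`, crux H413): the GENERIC step behind the
idele-norm unfolding `∫_{E^×∖𝕀_E} g(N_{E/F} x) dx = K ∫_{F^×∖F^×N(𝕀_E)} g` (FILE 3b `IdeleNormUnfolding`). It extends
★ `CoveringWeightsPushforward` (`exists_lintegral_comp_mul_weight_eq_mul_setLIntegral`: `α : G ↠ Q` open surjective) to a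
continuous `α : G →* Q` that is NOT surjective but whose image is co-discrete in the relevant sense: there is a countable
DISCRETE subgroup `P ≤ Q` containing `α(Γ)` with `H = P ⊔ α(G)` OPEN in `Q`. The trick: the extended homomorphism

  `α♯ : G × P →* H`, `(x, p) ↦ α(x) · p`

(inline `MonoidHom.mk'`, no definition) IS surjective and open (open mapping theorem, `G × P` is σ-compact), the lattice
`Γ × P` maps onto `P`, the Haar measure of `G × P` is `μG ⊗ (counting)`, the Haar measure of the open `H` is the
restriction of `μQ` (Mathlib `IsHaarMeasure.comap`), and the fibre `ker α♯ ≅ α⁻¹(P)` has finite covolume modulo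
`Γ × P ∩ ker α♯ ≅ Γ`-translates as soon as a compact `C ⊆ G` meets every `Γ`-orbit of `α⁻¹(P)` (hypothesis `hcov`; in the
idele instance: Hasse's norm theorem + the compactness of `E¹∖𝕀_E¹`).

* §1 ALGEBRA of `α♯`: `mul_coe_mem_sup_range`, `supExt_mul`, `supExt_apply`, `supExt_surjective`, `mem_ker_supExt_iff`,
  **`map_prod_top_supExt`** (`(Γ × P) ↦ P ∩ H` when `α(Γ) ≤ P`).
* §2 TOPOLOGY: `continuous_supExt`, `locallyCompactSpace_of_discreteTopology`, **`isOpenMap_supExt`** (open mapping theorem).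
* §3 THE THEOREM **`exists_lintegral_comp_mul_weight_eq_mul_setLIntegral_inter_sup`**: for LCSC abelian `G`, `Q` with Haar
  measures `μG`, `μQ`, continuous `α`, countable discrete `P ≤ Q` with `P ⊔ α.range` open, countable discrete `Γ ≤ G` with
  `α(Γ) ≤ P`, and a compact `C ⊆ G` with `∀ x, α x ∈ P → ∃ γ ∈ Γ, γ x ∈ C`: there is `K ∈ (0, ∞)` such that for every
  `Γ`-covering weight `w`, every measurable `𝓕 ⊆ Q` that is a strict fundamental domain for `P` (`∀ q, ∃! p : P, p • q ∈ 𝓕`)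
  and every Borel `P`-invariant `g : Q → [0, ∞]`:
  **`∫⁻ x, g (α x) * w x ∂μG = K * ∫⁻ q in 𝓕 ∩ ↑(P ⊔ α.range), g q ∂μQ`.**

## References

* G. B. Folland, *A Course in Abstract Harmonic Analysis* (1995), §2.6 Thm. 2.49 [Folland1995].
* M. S. Raghunathan, *Discrete subgroups of Lie groups* (1972), Ch. I §1.4 [Raghunathan1972].
* J. D. Rogawski, *Automorphic Representations of Unitary Groups in Three Variables* (1990), §7.2 (p. 94) [Rogawski1990].
-/

set_option autoImplicit false

noncomputable section

open _root_.MeasureTheory _root_.MeasureTheory.Measure Set Filter Function Topology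
open scoped ENNReal NNReal Pointwise

namespace Literature.MeasureTheory.Group

/-! ## §1 Algebra of the extended homomorphism `α♯ : G × P →* P ⊔ α(G)` -/

section SupAlgebra

variable {G Q : Type*} [CommGroup G] [CommGroup Q] (α : G →* Q) (P : Subgroup Q)

/-- `α(x) · p ∈ P ⊔ α(G)` for `x ∈ G`, `p ∈ P`. [cite: Folland1995, §2.6] -/
theorem mul_coe_mem_sup_range (x : G × P) : α x.1 * (x.2 : Q) ∈ P ⊔ α.range :=
  (P ⊔ α.range).mul_mem (Subgroup.mem_sup_right ⟨x.1, rfl⟩) (Subgroup.mem_sup_left x.2.2)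

/-- **`(x, p) ↦ α(x) p` is multiplicative** (the groups are abelian). [cite: Folland1995, §2.6] -/
theorem supExt_mul (x y : G × P) :
    (⟨α (x * y).1 * ((x * y).2 : Q), mul_coe_mem_sup_range α P (x * y)⟩ : ↥(P ⊔ α.range)) =
      ⟨α x.1 * (x.2 : Q), mul_coe_mem_sup_range α P x⟩ * ⟨α y.1 * (y.2 : Q), mul_coe_mem_sup_range α P y⟩ :=
  Subtype.ext (show α (x * y).1 * ((x * y).2 : Q) = α x.1 * (x.2 : Q) * (α y.1 * (y.2 : Q)) by
    rw [Prod.fst_mul, Prod.snd_mul, map_mul, Subgroup.coe_mul, mul_mul_mul_comm])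

/-- `α♯ (x, p) = α(x) p` in `Q` (definitional). [cite: Folland1995, §2.6] -/
theorem supExt_apply (x : G × P) : (((MonoidHom.mk' (fun x : G × P => (⟨α x.1 * (x.2 : Q), mul_coe_mem_sup_range α P x⟩ : ↥(P ⊔ α.range)))
      (supExt_mul α P)) x : ↥(P ⊔ α.range)) : Q) = α x.1 * (x.2 : Q) := rfl

/-- **`α♯` is surjective onto `P ⊔ α(G)`** (`Subgroup.mem_sup` in an abelian group). [cite: Folland1995, §2.6] -/
theorem supExt_surjective : Function.Surjective (MonoidHom.mk' (fun x : G × P => (⟨α x.1 * (x.2 : Q), mul_coe_mem_sup_range α P x⟩ : ↥(P ⊔ α.range)))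
      (supExt_mul α P)) := by
  rintro ⟨h, hh⟩
  obtain ⟨p, hp, z, ⟨x, rfl⟩, hpz⟩ := Subgroup.mem_sup.1 hh
  exact ⟨(x, ⟨p, hp⟩), Subtype.ext ((mul_comm _ _).trans hpz)⟩

/-- Membership in `ker α♯`: `α(x) p = 1`. [cite: Folland1995, §2.6] -/
theorem mem_ker_supExt_iff (x : G × P) : x ∈ (MonoidHom.mk' (fun x : G × P => (⟨α x.1 * (x.2 : Q), mul_coe_mem_sup_range α P x⟩ : ↥(P ⊔ α.range)))
      (supExt_mul α P)).ker ↔ α x.1 * (x.2 : Q) = 1 := by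
  rw [MonoidHom.mem_ker, Subtype.ext_iff]
  exact Iff.rfl

/-- **`α♯(Γ × P) = P ∩ H`**: when `α(Γ) ≤ P` the lattice `Γ × P` of `G × P` maps onto the copy of `P` inside `H = P ⊔ α(G)`.
[cite: Raghunathan1972, Ch. I §1.4] -/
theorem map_prod_top_supExt (Γ : Subgroup G) (hΓ : Γ.map α ≤ P) :
    (Γ.prod (⊤ : Subgroup P)).map (MonoidHom.mk' (fun x : G × P => (⟨α x.1 * (x.2 : Q), mul_coe_mem_sup_range α P x⟩ : ↥(P ⊔ α.range)))
      (supExt_mul α P)) = P.comap (P ⊔ α.range).subtype := by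
  ext h
  constructor
  · rintro ⟨⟨x, p⟩, hxp, rfl⟩
    have hx : x ∈ Γ := (Subgroup.mem_prod.1 hxp).1
    show α x * (p : Q) ∈ P
    exact P.mul_mem (hΓ ⟨x, hx, rfl⟩) p.2
  · intro hh
    have hh' : (h : Q) ∈ P := hh
    refine ⟨(1, ⟨(h : Q), hh'⟩), Subgroup.mem_prod.2 ⟨Γ.one_mem, Subgroup.mem_top _⟩, Subtype.ext ?_⟩
    show α 1 * (h : Q) = h
    rw [map_one, one_mul]

end SupAlgebra

/-! ## §2 Topology: continuity and openness of `α♯` -/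

section SupTopology

variable {G Q : Type*} [CommGroup G] [TopologicalSpace G] [IsTopologicalGroup G]
  [CommGroup Q] [TopologicalSpace Q] [IsTopologicalGroup Q] (α : G →* Q) (P : Subgroup Q)

omit [IsTopologicalGroup G] in
/-- **`α♯` is continuous.** [cite: Folland1995, §2.6] -/
theorem continuous_supExt (hαc : Continuous α) : Continuous (MonoidHom.mk' (fun x : G × P => (⟨α x.1 * (x.2 : Q), mul_coe_mem_sup_range α P x⟩ : ↥(P ⊔ α.range)))
      (supExt_mul α P)) :=
  Continuous.subtype_mk ((hαc.comp continuous_fst).mul (continuous_subtype_val.comp continuous_snd)) _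

omit [IsTopologicalGroup G] [IsTopologicalGroup Q] in
/-- A discrete space is locally compact (singletons are compact neighbourhoods). [cite: Folland1995, §2.6] -/
theorem locallyCompactSpace_of_discreteTopology {X : Type*} [TopologicalSpace X] [DiscreteTopology X] :
    LocallyCompactSpace X :=
  ⟨fun x _ hn => ⟨{x}, mem_nhds_discrete.2 (Set.mem_singleton x),
    Set.singleton_subset_iff.2 (mem_of_mem_nhds hn), isCompact_singleton⟩⟩

/-- **`α♯` is an open map onto the open subgroup `H = P ⊔ α(G)`** — the open mapping theorem (Mathlib
`MonoidHom.isOpenMap_of_sigmaCompact`) for the continuous surjection `α♯` of the σ-compact `G × P` (`G` second countable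
locally compact, `P` countable discrete) onto the locally compact `H` (open in `Q`). [cite: Folland1995, §2.6] -/
theorem isOpenMap_supExt [LocallyCompactSpace G] [SecondCountableTopology G] [LocallyCompactSpace Q] [T2Space Q]
    [DiscreteTopology P] [Countable P] (hαc : Continuous α) (hH : IsOpen ((P ⊔ α.range : Subgroup Q) : Set Q)) :
    IsOpenMap (MonoidHom.mk' (fun x : G × P => (⟨α x.1 * (x.2 : Q), mul_coe_mem_sup_range α P x⟩ : ↥(P ⊔ α.range)))
      (supExt_mul α P)) := by
  haveI : LocallyCompactSpace P := locallyCompactSpace_of_discreteTopology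
  haveI : SigmaCompactSpace P := SigmaCompactSpace.of_countable (Set.range fun p : P => ({p} : Set P))
    (Set.countable_range _) (by rintro _ ⟨p, rfl⟩; exact isCompact_singleton)
    (by rw [Set.sUnion_range]; exact Set.iUnion_of_singleton P)
  haveI : LocallyCompactSpace ↥(P ⊔ α.range) := hH.locallyCompactSpace
  exact MonoidHom.isOpenMap_of_sigmaCompact _ (supExt_surjective α P) (continuous_supExt α P hαc)

end SupTopology

/-! ## §3 The unfolding theorem for a homomorphism with co-discrete image -/

section SupMain

variable {G Q : Type*} [CommGroup G] [TopologicalSpace G] [IsTopologicalGroup G] [LocallyCompactSpace G]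
  [SecondCountableTopology G] [T2Space G] [MeasurableSpace G] [BorelSpace G]
  [CommGroup Q] [TopologicalSpace Q] [IsTopologicalGroup Q] [LocallyCompactSpace Q]
  [SecondCountableTopology Q] [T2Space Q] [MeasurableSpace Q] [BorelSpace Q]
  (α : G →* Q) (P : Subgroup Q) (Γ : Subgroup G)

omit [TopologicalSpace G] [IsTopologicalGroup G] [LocallyCompactSpace G] [SecondCountableTopology G] [T2Space G] [BorelSpace G]
  [IsTopologicalGroup Q] [LocallyCompactSpace Q] in
/-- The weight `w(x) · 1_{p = 1}` on `G × P` is a `(Γ × P)`-covering weight when `w` is a `Γ`-covering weight.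
[cite: Raghunathan1972, Ch. I §1.4] -/
theorem isCoveringWeight_prod_indicator {w : G → ℝ≥0∞}
    (hw : IsCoveringWeight Γ w) :
    IsCoveringWeight (Γ.prod (⊤ : Subgroup P))
      (fun z : G × P => w z.1 * ({(1 : P)} : Set P).indicator (1 : P → ℝ≥0∞) z.2) := by
  refine ⟨(hw.measurable.comp measurable_fst).mul
    ((measurable_one.indicator (measurableSet_singleton (1 : P))).comp measurable_snd), fun z => ?_⟩
  -- the inner sum over `P` picks out `p = z.2⁻¹`
  have hinner : ∀ γ : Γ, ∑' p : P, w ((γ : G) * z.1) * ({(1 : P)} : Set P).indicator (1 : P → ℝ≥0∞) (p * z.2) =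
      w ((γ : G) * z.1) := by
    intro γ
    rw [ENNReal.tsum_mul_left, tsum_eq_single z.2⁻¹]
    · rw [Set.indicator_of_mem (show z.2⁻¹ * z.2 ∈ ({(1 : P)} : Set P) from inv_mul_cancel z.2), Pi.one_apply,
        mul_one]
    · intro p hp
      rw [Set.indicator_of_notMem]
      rw [Set.mem_singleton_iff]
      exact fun h => hp (eq_inv_of_mul_eq_one_left h)
  -- reindex the lattice `Γ × P` by the product type
  let e : ↥(Γ.prod (⊤ : Subgroup P)) ≃ Γ × P :=
    { toFun := fun σ => (⟨σ.1.1, (Subgroup.mem_prod.1 σ.2).1⟩, σ.1.2)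
      invFun := fun τ => ⟨((τ.1 : G), (τ.2 : P)), Subgroup.mem_prod.2 ⟨τ.1.2, Subgroup.mem_top _⟩⟩
      left_inv := fun σ => rfl
      right_inv := fun τ => rfl }
  rw [coveringSum_apply, ← e.symm.tsum_eq]
  show ∑' τ : Γ × P, w ((τ.1 : G) * z.1) * ({(1 : P)} : Set P).indicator (1 : P → ℝ≥0∞) (τ.2 * z.2) = 1
  rw [ENNReal.tsum_prod']
  show ∑' (γ : Γ) (p : P), w ((γ : G) * z.1) * ({(1 : P)} : Set P).indicator (1 : P → ℝ≥0∞) (p * z.2) = 1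
  simp only [hinner]
  have h1 := hw.coveringSum_eq z.1
  rw [coveringSum_apply] at h1
  exact h1

/-- **UNFOLDING ALONG A HOMOMORPHISM WITH CO-DISCRETE IMAGE.** Let `G`, `Q` be locally compact second countable Hausdorff
abelian groups with Haar measures `μG`, `μQ`; `α : G →* Q` continuous; `P ≤ Q` a countable discrete subgroup with
`H = P ⊔ α(G)` OPEN; `Γ ≤ G` a countable discrete subgroup with `α(Γ) ≤ P`; and `C ⊆ G` compact such that every `x` with
`α x ∈ P` has a `Γ`-translate in `C` (finite covolume of the fibre). Then there is `K ∈ (0, ∞)` such that for every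
`Γ`-covering weight `w` on `G`, every measurable strict fundamental domain `𝓕 ⊆ Q` of `P` (`∀ q, ∃! p : P, p • q ∈ 𝓕`) and every
Borel `P`-invariant `g : Q → [0, ∞]`:

  `∫⁻ g(α x) w(x) dμG = K · ∫⁻_{𝓕 ∩ H} g dμQ`  — i.e. `∫_{Γ∖G} g ∘ α = K ∫_{P∖H} g`.

Proof: ★ `exists_lintegral_comp_mul_weight_eq_mul_setLIntegral` for the open surjection `α♯ : G × P ↠ H` (§1–§2) with the
lattice `Γ × P ↦ P ∩ H`, the Haar measures `μG ⊗ #` and `μQ|_H`, the weight `w ⊗ 1_{1}` and the fibre weight supported near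
`C × {finite set}`. (Rogawski p. 94: `∫_{𝐙M∖𝐌} … = m(𝐙S∖𝐒) ∫_{NE^*∖NI_E} …`.) [cite: Folland1995, §2.6 Thm. 2.49]
[cite: Raghunathan1972, Ch. I §1.4] [cite: Rogawski1990, §7.2 (p. 94)] -/
theorem exists_lintegral_comp_mul_weight_eq_mul_setLIntegral_inter_sup (hαc : Continuous α) [DiscreteTopology P]
    [Countable P] (hH : IsOpen ((P ⊔ α.range : Subgroup Q) : Set Q)) [DiscreteTopology Γ] [Countable Γ]
    (hΓ : Γ.map α ≤ P) (μG : Measure G) [IsHaarMeasure μG] (μQ : Measure Q) [IsHaarMeasure μQ]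
    {C : Set G} (hC : IsCompact C) (hcov : ∀ x : G, α x ∈ P → ∃ γ ∈ Γ, γ * x ∈ C) :
    ∃ K : ℝ≥0∞, K ≠ 0 ∧ K ≠ ∞ ∧ ∀ w : G → ℝ≥0∞, IsCoveringWeight Γ w →
      ∀ 𝓕 : Set Q, MeasurableSet 𝓕 → (∀ q : Q, ∃! p : P, p • q ∈ 𝓕) →
      ∀ g : Q → ℝ≥0∞, Measurable g → (∀ p ∈ P, ∀ q, g (p * q) = g q) →
        ∫⁻ x, g (α x) * w x ∂μG = K * ∫⁻ q in 𝓕 ∩ ↑(P ⊔ α.range), g q ∂μQ := by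
  -- instances on `P`, `G × P`, `H`
  haveI : LocallyCompactSpace P := locallyCompactSpace_of_discreteTopology
  haveI : LocallyCompactSpace ↥(P ⊔ α.range) := hH.locallyCompactSpace
  haveI : IsHaarMeasure (Measure.count : Measure P) :=
    { lt_top_of_isCompact := fun K hK => Measure.count_apply_lt_top.2 hK.finite_of_discrete
      map_mul_left_eq_self := fun p => map_mul_left_eq_self Measure.count p
      open_pos := fun U _ hne => by
        rw [Ne, Measure.count_eq_zero_iff]
        exact hne.ne_empty }
  haveI : IsHaarMeasure (μQ.comap (Subtype.val : ↥(P ⊔ α.range) → Q)) :=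
    IsHaarMeasure.comap (mH := (inferInstance : MeasurableMul Q)) μQ (f := (P ⊔ α.range).subtype)
      hH.isOpenEmbedding_subtypeVal
  -- the lattice `Γ × P` is discrete and countable
  haveI : DiscreteTopology ↥(Γ.prod (⊤ : Subgroup P)) :=
    DiscreteTopology.of_continuous_injective
      (f := fun σ : ↥(Γ.prod (⊤ : Subgroup P)) => ((⟨σ.1.1, (Subgroup.mem_prod.1 σ.2).1⟩ : Γ), σ.1.2))
      ((Continuous.subtype_mk (continuous_fst.comp continuous_subtype_val) _).prodMk
        (continuous_snd.comp continuous_subtype_val))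
      (fun σ σ' h => Subtype.ext (Prod.ext (congrArg (fun z : Γ × P => (z.1 : G)) h)
        (congrArg (fun z : Γ × P => z.2) h)))
  haveI : Countable ↥(Γ.prod (⊤ : Subgroup P)) :=
    (show Function.Injective (fun σ : ↥(Γ.prod (⊤ : Subgroup P)) =>
        ((⟨σ.1.1, (Subgroup.mem_prod.1 σ.2).1⟩ : Γ), σ.1.2)) from
      fun σ σ' h => Subtype.ext (Prod.ext (congrArg (fun z : Γ × P => (z.1 : G)) h)
        (congrArg (fun z : Γ × P => z.2) h))).countable
  -- the fibre `ker α♯` is closed; Haar measure on it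
  have hclosed : IsClosed (((MonoidHom.mk' (fun x : G × P => (⟨α x.1 * (x.2 : Q), mul_coe_mem_sup_range α P x⟩ : ↥(P ⊔ α.range)))
      (supExt_mul α P)).ker : Subgroup (G × P)) : Set (G × P)) :=
    isClosed_ker_of_continuous (MonoidHom.mk' (fun x : G × P => (⟨α x.1 * (x.2 : Q), mul_coe_mem_sup_range α P x⟩ : ↥(P ⊔ α.range)))
      (supExt_mul α P)) (continuous_supExt α P hαc)
  haveI : LocallyCompactSpace (MonoidHom.mk' (fun x : G × P => (⟨α x.1 * (x.2 : Q), mul_coe_mem_sup_range α P x⟩ : ↥(P ⊔ α.range)))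
      (supExt_mul α P)).ker := hclosed.locallyCompactSpace
  -- the finite set `K₁ = {p : p⁻¹ ∈ α(C)}` and the compact set `C' = (C × K₁) ∩ ker α♯`
  have hfin : (α '' C ∩ (P : Set Q)).Finite := by
    haveI : DiscreteTopology ↥(α '' C ∩ (P : Set Q)) :=
      DiscreteTopology.of_subset ‹DiscreteTopology P› Set.inter_subset_right
    exact ((hC.image hαc).inter_right (Subgroup.isClosed_of_discrete (H := P))).finite
      (isDiscrete_iff_discreteTopology.2 inferInstance)
  have hK₁f : {p : P | ((p : Q))⁻¹ ∈ α '' C}.Finite := by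
    refine Set.Finite.of_finite_image (f := fun p : P => ((p : Q))⁻¹) (hfin.subset ?_) ?_
    · rintro _ ⟨p, hp, rfl⟩
      exact ⟨hp, P.inv_mem p.2⟩
    · intro p _ p' _ h
      exact Subtype.ext (inv_injective h)
  have hC'c : IsCompact (Subtype.val ⁻¹' (C ×ˢ {p : P | ((p : Q))⁻¹ ∈ α '' C}) : Set (MonoidHom.mk' (fun x : G × P => (⟨α x.1 * (x.2 : Q), mul_coe_mem_sup_range α P x⟩ : ↥(P ⊔ α.range)))
      (supExt_mul α P)).ker) :=
    hclosed.isClosedEmbedding_subtypeVal.isCompact_preimage (hC.prod hK₁f.isCompact)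
  have hC'm : MeasurableSet (Subtype.val ⁻¹' (C ×ˢ {p : P | ((p : Q))⁻¹ ∈ α '' C}) : Set (MonoidHom.mk' (fun x : G × P => (⟨α x.1 * (x.2 : Q), mul_coe_mem_sup_range α P x⟩ : ↥(P ⊔ α.range)))
      (supExt_mul α P)).ker) :=
    hC'c.isClosed.measurableSet
  -- a covering weight of finite integral on the fibre (every orbit of the fibre lattice meets `C'`)
  haveI : DiscreteTopology ((Γ.prod (⊤ : Subgroup P)).subgroupOf (MonoidHom.mk' (fun x : G × P => (⟨α x.1 * (x.2 : Q), mul_coe_mem_sup_range α P x⟩ : ↥(P ⊔ α.range)))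
      (supExt_mul α P)).ker) :=
    DiscreteTopology.of_continuous_injective
      (f := fun σ : (Γ.prod (⊤ : Subgroup P)).subgroupOf (MonoidHom.mk' (fun x : G × P => (⟨α x.1 * (x.2 : Q), mul_coe_mem_sup_range α P x⟩ : ↥(P ⊔ α.range)))
      (supExt_mul α P)).ker =>
        (⟨((σ : (MonoidHom.mk' (fun x : G × P => (⟨α x.1 * (x.2 : Q), mul_coe_mem_sup_range α P x⟩ : ↥(P ⊔ α.range)))
      (supExt_mul α P)).ker) : G × P), Subgroup.mem_subgroupOf.1 σ.2⟩ : ↥(Γ.prod (⊤ : Subgroup P))))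
      (Continuous.subtype_mk (continuous_subtype_val.comp continuous_subtype_val) _)
      (fun σ σ' h => Subtype.ext (Subtype.ext (congrArg (fun z : ↥(Γ.prod (⊤ : Subgroup P)) => (z : G × P)) h)))
  haveI : Countable ((Γ.prod (⊤ : Subgroup P)).subgroupOf (MonoidHom.mk' (fun x : G × P => (⟨α x.1 * (x.2 : Q), mul_coe_mem_sup_range α P x⟩ : ↥(P ⊔ α.range)))
      (supExt_mul α P)).ker) :=
    (show Function.Injective (fun σ : (Γ.prod (⊤ : Subgroup P)).subgroupOf (MonoidHom.mk' (fun x : G × P => (⟨α x.1 * (x.2 : Q), mul_coe_mem_sup_range α P x⟩ : ↥(P ⊔ α.range)))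
      (supExt_mul α P)).ker =>
        (⟨((σ : (MonoidHom.mk' (fun x : G × P => (⟨α x.1 * (x.2 : Q), mul_coe_mem_sup_range α P x⟩ : ↥(P ⊔ α.range)))
      (supExt_mul α P)).ker) : G × P), Subgroup.mem_subgroupOf.1 σ.2⟩ : ↥(Γ.prod (⊤ : Subgroup P)))) from
      fun σ σ' h => Subtype.ext (Subtype.ext
        (congrArg (fun z : ↥(Γ.prod (⊤ : Subgroup P)) => (z : G × P)) h))).countable
  obtain ⟨wS, hwS⟩ := exists_isCoveringWeight ((Γ.prod (⊤ : Subgroup P)).subgroupOf (MonoidHom.mk' (fun x : G × P => (⟨α x.1 * (x.2 : Q), mul_coe_mem_sup_range α P x⟩ : ↥(P ⊔ α.range)))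
      (supExt_mul α P)).ker)
  haveI : MeasurableConstSMul ((Γ.prod (⊤ : Subgroup P)).subgroupOf (MonoidHom.mk' (fun x : G × P => (⟨α x.1 * (x.2 : Q), mul_coe_mem_sup_range α P x⟩ : ↥(P ⊔ α.range)))
      (supExt_mul α P)).ker) (MonoidHom.mk' (fun x : G × P => (⟨α x.1 * (x.2 : Q), mul_coe_mem_sup_range α P x⟩ : ↥(P ⊔ α.range)))
      (supExt_mul α P)).ker :=
    ⟨fun σ => measurable_const_mul ((σ : (Γ.prod (⊤ : Subgroup P)).subgroupOf (MonoidHom.mk' (fun x : G × P => (⟨α x.1 * (x.2 : Q), mul_coe_mem_sup_range α P x⟩ : ↥(P ⊔ α.range)))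
      (supExt_mul α P)).ker) : (MonoidHom.mk' (fun x : G × P => (⟨α x.1 * (x.2 : Q), mul_coe_mem_sup_range α P x⟩ : ↥(P ⊔ α.range)))
      (supExt_mul α P)).ker)⟩
  haveI : SMulInvariantMeasure ((Γ.prod (⊤ : Subgroup P)).subgroupOf (MonoidHom.mk' (fun x : G × P => (⟨α x.1 * (x.2 : Q), mul_coe_mem_sup_range α P x⟩ : ↥(P ⊔ α.range)))
      (supExt_mul α P)).ker) (MonoidHom.mk' (fun x : G × P => (⟨α x.1 * (x.2 : Q), mul_coe_mem_sup_range α P x⟩ : ↥(P ⊔ α.range)))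
      (supExt_mul α P)).ker
      (Measure.haar : Measure (MonoidHom.mk' (fun x : G × P => (⟨α x.1 * (x.2 : Q), mul_coe_mem_sup_range α P x⟩ : ↥(P ⊔ α.range)))
      (supExt_mul α P)).ker) :=
    ⟨fun σ t _ht => by
      rw [show (fun x : (MonoidHom.mk' (fun x : G × P => (⟨α x.1 * (x.2 : Q), mul_coe_mem_sup_range α P x⟩ : ↥(P ⊔ α.range)))
      (supExt_mul α P)).ker => σ • x) ⁻¹' t =
          (fun x : (MonoidHom.mk' (fun x : G × P => (⟨α x.1 * (x.2 : Q), mul_coe_mem_sup_range α P x⟩ : ↥(P ⊔ α.range)))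
      (supExt_mul α P)).ker => ((σ : (Γ.prod (⊤ : Subgroup P)).subgroupOf (MonoidHom.mk' (fun x : G × P => (⟨α x.1 * (x.2 : Q), mul_coe_mem_sup_range α P x⟩ : ↥(P ⊔ α.range)))
      (supExt_mul α P)).ker) : (MonoidHom.mk' (fun x : G × P => (⟨α x.1 * (x.2 : Q), mul_coe_mem_sup_range α P x⟩ : ↥(P ⊔ α.range)))
      (supExt_mul α P)).ker) * x) ⁻¹' t
          from rfl, measure_preimage_mul]⟩
  have hmeet : ∀ s : (MonoidHom.mk' (fun x : G × P => (⟨α x.1 * (x.2 : Q), mul_coe_mem_sup_range α P x⟩ : ↥(P ⊔ α.range)))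
      (supExt_mul α P)).ker, 1 ≤ coveringSum ((Γ.prod (⊤ : Subgroup P)).subgroupOf (MonoidHom.mk' (fun x : G × P => (⟨α x.1 * (x.2 : Q), mul_coe_mem_sup_range α P x⟩ : ↥(P ⊔ α.range)))
      (supExt_mul α P)).ker)
      ((Subtype.val ⁻¹' (C ×ˢ {p : P | ((p : Q))⁻¹ ∈ α '' C}) : Set (MonoidHom.mk' (fun x : G × P => (⟨α x.1 * (x.2 : Q), mul_coe_mem_sup_range α P x⟩ : ↥(P ⊔ α.range)))
      (supExt_mul α P)).ker).indicator 1) s := by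
    intro s
    have hs : α (s : G × P).1 * (((s : G × P).2 : P) : Q) = 1 := (mem_ker_supExt_iff α P _).1 s.2
    have hsP : α (s : G × P).1 ∈ P := by
      rw [eq_inv_of_mul_eq_one_left hs]
      exact P.inv_mem (s : G × P).2.2
    obtain ⟨γ, hγ, hγs⟩ := hcov _ hsP
    have hαγs : α (γ * (s : G × P).1) ∈ P := by
      rw [map_mul]
      exact P.mul_mem (hΓ ⟨γ, hγ, rfl⟩) hsP
    -- the target point `t = (γ x, α(γ x)⁻¹) ∈ C' ∩ ker α♯`
    have htker : ((γ * (s : G × P).1, (⟨α (γ * (s : G × P).1), hαγs⟩ : P)⁻¹) : G × P) ∈ (MonoidHom.mk' (fun x : G × P => (⟨α x.1 * (x.2 : Q), mul_coe_mem_sup_range α P x⟩ : ↥(P ⊔ α.range)))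
      (supExt_mul α P)).ker := by
      rw [mem_ker_supExt_iff]
      exact mul_inv_cancel _
    set t : (MonoidHom.mk' (fun x : G × P => (⟨α x.1 * (x.2 : Q), mul_coe_mem_sup_range α P x⟩ : ↥(P ⊔ α.range)))
      (supExt_mul α P)).ker := ⟨_, htker⟩ with ht
    have htC : t ∈ (Subtype.val ⁻¹' (C ×ˢ {p : P | ((p : Q))⁻¹ ∈ α '' C}) : Set (MonoidHom.mk' (fun x : G × P => (⟨α x.1 * (x.2 : Q), mul_coe_mem_sup_range α P x⟩ : ↥(P ⊔ α.range)))
      (supExt_mul α P)).ker) := by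
      refine ⟨hγs, ?_⟩
      show (((⟨α (γ * (s : G × P).1), hαγs⟩ : P)⁻¹ : P) : Q)⁻¹ ∈ α '' C
      rw [Subgroup.coe_inv, inv_inv]
      exact ⟨_, hγs, rfl⟩
    have hσ : ((t * s⁻¹ : (MonoidHom.mk' (fun x : G × P => (⟨α x.1 * (x.2 : Q), mul_coe_mem_sup_range α P x⟩ : ↥(P ⊔ α.range)))
      (supExt_mul α P)).ker) : G × P) ∈ Γ.prod (⊤ : Subgroup P) := by
      refine Subgroup.mem_prod.2 ⟨?_, Subgroup.mem_top _⟩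
      show γ * (s : G × P).1 * ((s : G × P).1)⁻¹ ∈ Γ
      rw [mul_inv_cancel_right]
      exact hγ
    rw [coveringSum_apply]
    calc (1 : ℝ≥0∞) = (Subtype.val ⁻¹' (C ×ˢ {p : P | ((p : Q))⁻¹ ∈ α '' C}) : Set (MonoidHom.mk' (fun x : G × P => (⟨α x.1 * (x.2 : Q), mul_coe_mem_sup_range α P x⟩ : ↥(P ⊔ α.range)))
      (supExt_mul α P)).ker).indicator 1 t := by
          rw [Set.indicator_of_mem htC, Pi.one_apply]
      _ = (Subtype.val ⁻¹' (C ×ˢ {p : P | ((p : Q))⁻¹ ∈ α '' C}) : Set (MonoidHom.mk' (fun x : G × P => (⟨α x.1 * (x.2 : Q), mul_coe_mem_sup_range α P x⟩ : ↥(P ⊔ α.range)))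
      (supExt_mul α P)).ker).indicator 1
            ((⟨t * s⁻¹, Subgroup.mem_subgroupOf.2 hσ⟩ : (Γ.prod (⊤ : Subgroup P)).subgroupOf (MonoidHom.mk' (fun x : G × P => (⟨α x.1 * (x.2 : Q), mul_coe_mem_sup_range α P x⟩ : ↥(P ⊔ α.range)))
      (supExt_mul α P)).ker) • s) := by
          rw [Subgroup.smul_def, smul_eq_mul, Subgroup.coe_mk, inv_mul_cancel_right]
      _ ≤ ∑' σ : (Γ.prod (⊤ : Subgroup P)).subgroupOf (MonoidHom.mk' (fun x : G × P => (⟨α x.1 * (x.2 : Q), mul_coe_mem_sup_range α P x⟩ : ↥(P ⊔ α.range)))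
      (supExt_mul α P)).ker,
            (Subtype.val ⁻¹' (C ×ˢ {p : P | ((p : Q))⁻¹ ∈ α '' C}) : Set (MonoidHom.mk' (fun x : G × P => (⟨α x.1 * (x.2 : Q), mul_coe_mem_sup_range α P x⟩ : ↥(P ⊔ α.range)))
      (supExt_mul α P)).ker).indicator 1 (σ • s) :=
          ENNReal.le_tsum _
  have hle := lintegral_mul_le_inv_mul_setLIntegral_of_le_coveringSum_indicator (Measure.haar : Measure (MonoidHom.mk' (fun x : G × P => (⟨α x.1 * (x.2 : Q), mul_coe_mem_sup_range α P x⟩ : ↥(P ⊔ α.range)))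
      (supExt_mul α P)).ker)
    (F := fun _ => (1 : ℝ≥0∞)) measurable_const (fun _ _ => rfl) hwS.measurable (fun s => (hwS.coveringSum_eq s).le)
    hC'm one_ne_zero ENNReal.one_ne_top hmeet
  have hfinS : ∫⁻ s, wS s ∂(Measure.haar : Measure (MonoidHom.mk' (fun x : G × P => (⟨α x.1 * (x.2 : Q), mul_coe_mem_sup_range α P x⟩ : ↥(P ⊔ α.range)))
      (supExt_mul α P)).ker) ≠ ∞ := by
    refine ne_top_of_le_ne_top ?_ (le_trans (le_of_eq ?_) hle)
    · rw [inv_one, one_mul, setLIntegral_const, one_mul]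
      exact hC'c.measure_lt_top.ne
    · simp only [one_mul]
  -- ★ the unfolding theorem for the open surjection `α♯`
  obtain ⟨K, hK0, hKt, hK⟩ := exists_lintegral_comp_mul_weight_eq_mul_setLIntegral (MonoidHom.mk' (fun x : G × P => (⟨α x.1 * (x.2 : Q), mul_coe_mem_sup_range α P x⟩ : ↥(P ⊔ α.range)))
      (supExt_mul α P)) (Γ.prod (⊤ : Subgroup P))
    (continuous_supExt α P hαc) (isOpenMap_supExt α P hαc hH) (supExt_surjective α P) (μG.prod Measure.count)
    (μQ.comap (Subtype.val : ↥(P ⊔ α.range) → Q)) Measure.haar hwS hfinS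
  refine ⟨K, hK0, hKt, fun w hw 𝓕 h𝓕 huniq g hg hginv => ?_⟩
  have hmap := map_prod_top_supExt α P Γ hΓ
  -- the strict fundamental domain `𝓕 ∩ H` of `P ∩ H` in `H`
  have huniq' : ∀ h : ↥(P ⊔ α.range), ∃! l : ↥((Γ.prod (⊤ : Subgroup P)).map (MonoidHom.mk' (fun x : G × P => (⟨α x.1 * (x.2 : Q), mul_coe_mem_sup_range α P x⟩ : ↥(P ⊔ α.range)))
      (supExt_mul α P))),
      l • h ∈ (Subtype.val ⁻¹' 𝓕 : Set ↥(P ⊔ α.range)) := by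
    rw [hmap]
    intro h
    obtain ⟨p, hp, hpu⟩ := huniq (h : Q)
    refine ⟨⟨⟨(p : Q), Subgroup.mem_sup_left p.2⟩, (show ((⟨(p : Q), Subgroup.mem_sup_left p.2⟩ :
      ↥(P ⊔ α.range)) : Q) ∈ P from p.2)⟩, hp, fun l hl => ?_⟩
    have hl' : (⟨((l : ↥(P ⊔ α.range)) : Q), l.2⟩ : P) • (h : Q) ∈ 𝓕 := hl
    have := hpu _ hl'
    exact Subtype.ext (Subtype.ext (congrArg (fun p : P => (p : Q)) this))
  have hginv' : ∀ l ∈ (Γ.prod (⊤ : Subgroup P)).map (MonoidHom.mk' (fun x : G × P => (⟨α x.1 * (x.2 : Q), mul_coe_mem_sup_range α P x⟩ : ↥(P ⊔ α.range)))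
      (supExt_mul α P)), ∀ h : ↥(P ⊔ α.range),
      g (((l * h : ↥(P ⊔ α.range))) : Q) = g (h : Q) := by
    rw [hmap]
    intro l hl h
    rw [Subgroup.coe_mul]
    exact hginv _ hl _
  have key := hK (fun z : G × P => w z.1 * ({(1 : P)} : Set P).indicator (1 : P → ℝ≥0∞) z.2)
    (isCoveringWeight_prod_indicator P Γ hw) (Subtype.val ⁻¹' 𝓕) (measurable_subtype_coe h𝓕) huniq'
    (fun h => g (h : Q)) (hg.comp measurable_subtype_coe) hginv'
  -- left side: integrate out the counting measure
  have hL : ∫⁻ z : G × P, g ((((MonoidHom.mk' (fun x : G × P => (⟨α x.1 * (x.2 : Q), mul_coe_mem_sup_range α P x⟩ : ↥(P ⊔ α.range)))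
      (supExt_mul α P)) z : ↥(P ⊔ α.range))) : Q) *
      (w z.1 * ({(1 : P)} : Set P).indicator (1 : P → ℝ≥0∞) z.2) ∂(μG.prod Measure.count) =
      ∫⁻ x, g (α x) * w x ∂μG := by
    have hmeas : Measurable fun z : G × P => g ((((MonoidHom.mk' (fun x : G × P => (⟨α x.1 * (x.2 : Q), mul_coe_mem_sup_range α P x⟩ : ↥(P ⊔ α.range)))
      (supExt_mul α P)) z : ↥(P ⊔ α.range))) : Q) *
        (w z.1 * ({(1 : P)} : Set P).indicator (1 : P → ℝ≥0∞) z.2) :=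
      (hg.comp ((hαc.measurable.comp measurable_fst).mul (measurable_subtype_coe.comp measurable_snd))).mul
        ((hw.measurable.comp measurable_fst).mul
          ((measurable_one.indicator (measurableSet_singleton (1 : P))).comp measurable_snd))
    rw [lintegral_prod _ hmeas.aemeasurable]
    refine lintegral_congr fun x => ?_
    rw [lintegral_count, tsum_eq_single (1 : P)]
    · show g (α x * ((1 : P) : Q)) * (w x * ({(1 : P)} : Set P).indicator 1 (1 : P)) = g (α x) * w x
      rw [Subgroup.coe_one, mul_one, Set.indicator_of_mem (Set.mem_singleton _), Pi.one_apply, mul_one]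
    · intro p hp
      show g (α x * (p : Q)) * (w x * ({(1 : P)} : Set P).indicator 1 p) = 0
      rw [Set.indicator_of_notMem (fun h : p ∈ ({(1 : P)} : Set P) => hp (Set.mem_singleton_iff.1 h)), mul_zero,
        mul_zero]
  -- right side: the restricted Haar measure of the open subgroup
  have hR : ∫⁻ h in (Subtype.val ⁻¹' 𝓕 : Set ↥(P ⊔ α.range)), g (h : Q)
      ∂(μQ.comap (Subtype.val : ↥(P ⊔ α.range) → Q)) = ∫⁻ q in 𝓕 ∩ ↑(P ⊔ α.range), g q ∂μQ := by
    have h1 := setLIntegral_subtype (μ := μQ) hH.measurableSet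
      (Subtype.val ⁻¹' 𝓕 : Set ((P ⊔ α.range : Subgroup Q) : Set Q)) g
    rw [Subtype.image_preimage_coe, Set.inter_comm] at h1
    exact h1
  rw [← hL, key, hR]

end SupMain

end Literature.MeasureTheory.Group
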